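import Literature.AlgebraicGeometry.Resolution.LipmanProcedure
import Literature.AlgebraicGeometry.Resolution.HilbertSamuelStrata
import Literature.AlgebraicGeometry.Resolution.SurfaceResolutionReduction
import Literature.AlgebraicGeometry.Resolution.AlterationsNormalizationReduction
import Mathlib.Order.PiLex
import HarnessLib

/-!
# Route `UniversalCells`, crux `LocalToGlobal` (stmt-ResolutionOfSingularities-15232), line `Sketch`
# (idea `existence-certified-termination`) — shared definitions: the blind Hilbert–Samuel tower

Objects posited by the line (card `Cruxes/LocalToGlobal/Ideas/existence-certified-termination.md`,
skeleton `Cruxes/LocalToGlobal/Lines/Sketch.lean`), so that the registered stub files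
`UniversalCellsLocalToGlobal<Stub>.lean` state literally the registered signatures:

* `hsLexMaxLocus X N` — the points of `X` whose Cossart–Jannsen–Saito Hilbert–Samuel function
  `H^N_X(x) ∈ ℕ^ℕ` (`Scheme.hsFun`, CJS Def. 2.28) is maximal for the LEXICOGRAPHIC order
  (Mathlib `Pi.Lex` via `toLex`; a total order — one maximal value — unlike the product order of
  CJS's `X_max = Scheme.hsMaxLocus`, and insensitive to the level `N` once `N > dim X`);
* `hsCentre X f N : Closeds X`, `hsCentreIdeal X f N` — the closure of that locus cut back to
  `Sing X = X ∖ Reg X` (closed for `X` locally of finite type over a field), and its vanishing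
  ideal sheaf (reduced structure); non-zero on an integral scheme (`hsCentreIdeal_ne_bot`);
* `hsBlowup X f N`, `hsStep X f N = (Bl_Z X)^ν` with `hsStep.π` — **the blind step**: blow up the
  reduced centre, normalize; built on the tree's `blowup` / `normalization` verbatim as
  `lipmanStep` (`LipmanProcedure.lean`, which is the case "centre = all of `Sing X`"), with the
  same instances: integral, `IsFinite (normalizationι _)` (E. Noether, discharged in tree),
  proper, birational, normal stalks;
* `NormalVariety k` — bundled integral normal separated `k`-schemes of finite type (the tree's
  `NormalSurface` without the dimension field), `NormalVariety.step N` the blind step as an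
  endomap, `stepπ`, the tower maps `iterπ N n V : (step N)^[n] V → V`, and the predicate
  `IsResolvedOver N n V x` ("stage `n` of the tower is regular over `x`").

Only definitions, instances, their defining `rfl`/transport lemmas and the registered definitional glue `stub_hsTowerDefs` (`rfl`) live here; every statement
about the tower (the atom `stub_hsTransfer`, the globalization, the reduction to the
normalization) is a stub file of the line. Design choices: (i) the closure and the cut-back to
`Sing X` make `hsCentre` total (no excellence / `N > dim` hypothesis in the DEFINITION; on a
non-regular excellent `X` with `dim X < N` they change nothing); (ii) a regular `X` has empty
centre, so the step is then an isomorphism and the tower is constant up to isomorphism (never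
empty); (iii) `iterπ` is defined by structural recursion so that
`iterπ N (n+1) V = iterπ N n (V.step N) ≫ V.stepπ N` and `(step N)^[n+1] V = (step N)^[n] (V.step N)`
hold by `rfl`.

## Sources

* O. Zariski, Ann. of Math. 40 (1939) 639–689 (blow up, normalize; termination from local
  uniformization in dimension 2). [Zariski1939]
* J. Lipman, Ann. of Math. 107 (1978) 151–207, §2. [Lipman1978]
* Q. Liu, *Algebraic Geometry and Arithmetic Curves* (2002), §8.3.4 (3.11), Thm. 8.3.44. [Liu2002]
* V. Cossart, U. Jannsen, S. Saito, LNM 2270 (2020), Def. 2.28, Def. 2.35. [CossartJannsenSaito2020]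
-/

set_option linter.dupNamespace false -- mandated namespace of this single-conjunct summit

noncomputable section

open CategoryTheory AlgebraicGeometry TopologicalSpace Topology
open AlgebraicGeometry.Scheme.IdealSheafData
open Literature.AlgebraicGeometry.Resolution

namespace Summit.ResolutionOfSingularities.ResolutionOfSingularities.Theorems.LocalToGlobal.HSTower

universe u

/-! ## The centre and the blind step -/

section Step

variable {k : Type u} [Field k] (X : Scheme.{u}) (f : X ⟶ Spec (.of k)) [LocallyOfFiniteType f]

/-- The **lex-maximal Hilbert–Samuel locus** of `X` at level `N`: the points whose CJS
Hilbert–Samuel function `H^N_X(x) ∈ ℕ^ℕ` (`Scheme.hsFun`, CJS Def. 2.28) is maximal for the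
LEXICOGRAPHIC order on `ℕ^ℕ` (a total order, so there is a single maximal value).
[cite: CossartJannsenSaito2020, Def. 2.28 and Def. 2.35 (the product-order analogue `X_max`)] -/
def hsLexMaxLocus (N : ℕ) : Set X :=
  {x | ∀ y : X, toLex (Scheme.hsFun X N y) ≤ toLex (Scheme.hsFun X N x)}

/-- The **centre of the blind step**: the closure of the lex-maximal Hilbert–Samuel locus, cut
back to the singular locus `X ∖ Reg X` (closed: `Reg X` is open for `X` locally of finite type
over a field), as a closed subset of `X`. (On a non-regular excellent `X` with `dim X < N` the
lex-maximal locus is already closed and contained in `Sing X`; the closure and the intersection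
make the definition total.) [folklore] -/
def hsCentre (N : ℕ) : Closeds X :=
  ⟨closure (hsLexMaxLocus X N) ∩ (Scheme.regularLocus X)ᶜ,
    isClosed_closure.inter (isOpen_regularLocus_of_locallyOfFiniteType_field f).isClosed_compl⟩

/-- The points of the centre. [folklore] -/
@[simp] theorem coe_hsCentre (N : ℕ) :
    (hsCentre X f N : Set X) = closure (hsLexMaxLocus X N) ∩ (Scheme.regularLocus X)ᶜ := rfl

/-- The ideal sheaf of the centre "endowed with the reduced scheme structure": the vanishing
ideal sheaf of the closed subset `hsCentre X f N`. [folklore] -/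
def hsCentreIdeal (N : ℕ) : X.IdealSheafData :=
  vanishingIdeal (hsCentre X f N)

/-- The support of the centre ideal is the centre. [folklore] -/
@[simp] theorem coe_support_hsCentreIdeal (N : ℕ) :
    ((hsCentreIdeal X f N).support : Set X) =
      closure (hsLexMaxLocus X N) ∩ (Scheme.regularLocus X)ᶜ := by
  rw [hsCentreIdeal, coe_support_vanishingIdeal, coe_hsCentre]

/-- The centre lies in the singular locus. [folklore] -/
theorem coe_support_hsCentreIdeal_subset (N : ℕ) :
    ((hsCentreIdeal X f N).support : Set X) ⊆ (Scheme.regularLocus X)ᶜ := by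
  rw [coe_support_hsCentreIdeal]
  exact Set.inter_subset_right

/-- On an integral scheme the centre ideal is non-zero: the regular locus is dense, in
particular non-empty, and misses the centre. [folklore] -/
theorem hsCentreIdeal_ne_bot [IsIntegral X] (N : ℕ) : hsCentreIdeal X f N ≠ ⊥ := by
  intro h
  have hs : ((hsCentreIdeal X f N).support : Set X) = Set.univ := by
    rw [h, support_bot]; rfl
  obtain ⟨x, hx⟩ := (Scheme.dense_regularLocus X).nonempty
  have hx' : x ∈ ((hsCentreIdeal X f N).support : Set X) := hs ▸ Set.mem_univ x
  exact coe_support_hsCentreIdeal_subset X f N hx' hx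

/-- The blowing-up `Bl_{Z}(X)` of the centre (a chosen blow-up, `blowup`). [folklore] -/
abbrev hsBlowup (N : ℕ) : Scheme.{u} :=
  blowup (hsCentreIdeal X f N)

/-- Its structure morphism `Bl_Z(X) → X`. [folklore] -/
abbrev hsBlowup.π (N : ℕ) : hsBlowup X f N ⟶ X :=
  blowup.π (hsCentreIdeal X f N)

/-- The blowing-up of the centre of an integral scheme is integral (Stacks 02ND). [folklore] -/
instance hsBlowup.isIntegral [IsIntegral X] (N : ℕ) : IsIntegral (hsBlowup X f N) :=
  (blowup.isBlowup _).isIntegral (hsCentreIdeal_ne_bot X f N)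

/-- The blowing-up of the centre is proper (Stacks 02NS; `X` is locally Noetherian). [folklore] -/
instance hsBlowup.isProper_π (N : ℕ) : IsProper (hsBlowup.π X f N) :=
  haveI : IsLocallyNoetherian X := LocallyOfFiniteType.isLocallyNoetherian f
  (blowup.isBlowup _).isProper

/-- The blowing-up of the centre of an integral scheme is birational. [folklore] -/
theorem hsBlowup.isBirational [IsIntegral X] (N : ℕ) : IsBirational (hsBlowup.π X f N) :=
  (blowup.isBlowup _).isBirational' (hsCentreIdeal_ne_bot X f N)

/-- The blowing-up of the centre is an isomorphism over the complement of the centre, which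
contains the regular locus (Stacks 02OS). [folklore] -/
theorem hsBlowup.isIso_restrict_centreCompl (N : ℕ) :
    IsIso (hsBlowup.π X f N ∣_ centreCompl (hsCentreIdeal X f N)) ∧
      Scheme.regularLocus X ⊆ ((centreCompl (hsCentreIdeal X f N) : X.Opens) : Set X) := by
  refine ⟨(blowup.isBlowup _).isIso_compl, fun x hx => ?_⟩
  change x ∈ ((hsCentreIdeal X f N).support : Set X)ᶜ
  exact fun hx' => coe_support_hsCentreIdeal_subset X f N hx' hx

variable [IsIntegral X]

/-- **The blind step**: the normalization of the blowing-up of the reduced lex-maximal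
Hilbert–Samuel locus (cut back to `Sing X`). [folklore] -/
def hsStep (N : ℕ) : Scheme.{u} :=
  normalization (hsBlowup X f N)

/-- The structure morphism `X₁ → X` of the blind step. [folklore] -/
def hsStep.π (N : ℕ) : hsStep X f N ⟶ X :=
  normalizationι (hsBlowup X f N) ≫ hsBlowup.π X f N

/-- The blind step produces an integral scheme. [folklore] -/
instance hsStep.isIntegral (N : ℕ) : IsIntegral (hsStep X f N) :=
  inferInstanceAs (IsIntegral (normalization (hsBlowup X f N)))

/-- The normalization half of the blind step is finite (E. Noether). [folklore] -/
instance hsStep.instIsFiniteNormalizationι (N : ℕ) : IsFinite (normalizationι (hsBlowup X f N)) :=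
  isFinite_normalizationι (hsBlowup X f N) NoetherFiniteIntegralClosure_holds
    (hsBlowup.π X f N ≫ f)

/-- The blind step `X₁ → X` is proper. [folklore] -/
instance hsStep.isProper_π (N : ℕ) : IsProper (hsStep.π X f N) := by
  unfold hsStep.π hsStep
  infer_instance

/-- The blind step `X₁ → X` is birational. [folklore] -/
theorem hsStep.isBirational (N : ℕ) : IsBirational (hsStep.π X f N) :=
  (isBirational_normalizationι (hsBlowup X f N) (hsBlowup.π X f N ≫ f)).comp
    (hsBlowup.isBirational X f N)

/-- The blind step produces a normal scheme. [folklore] -/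
theorem hsStep.isIntegrallyClosed_stalk (N : ℕ) (x : hsStep X f N) :
    IsIntegrallyClosed ((hsStep X f N).presheaf.stalk x) :=
  isIntegrallyClosed_stalk_normalization (hsBlowup X f N) x

end Step

/-- A **normal variety over the field `k`** (bundled, so that the blind step iterates): an
integral, normal, separated `k`-scheme of finite type. [folklore] -/
structure NormalVariety (k : Type u) [Field k] where
  /-- the underlying scheme -/
  X : Scheme.{u}
  /-- the structure morphism to `Spec k` -/
  hom : X ⟶ Spec (.of k)
  isSeparated : IsSeparated hom
  locallyOfFiniteType : LocallyOfFiniteType hom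
  quasiCompact : QuasiCompact hom
  isIntegral : IsIntegral X
  /-- all local rings are integrally closed -/
  normal : ∀ x : X, IsIntegrallyClosed (X.presheaf.stalk x)

namespace NormalVariety

variable {k : Type u} [Field k]

/-- A normal variety is separated over `k`. [folklore] -/
instance instIsSeparatedHom (V : NormalVariety k) : IsSeparated V.hom := V.isSeparated

/-- A normal variety is locally of finite type over `k`. [folklore] -/
instance instLocallyOfFiniteTypeHom (V : NormalVariety k) : LocallyOfFiniteType V.hom :=
  V.locallyOfFiniteType

/-- A normal variety is quasi-compact over `k`. [folklore] -/
instance instQuasiCompactHom (V : NormalVariety k) : QuasiCompact V.hom := V.quasiCompact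

/-- A normal variety is an integral scheme. [folklore] -/
instance instIsIntegralX (V : NormalVariety k) : IsIntegral V.X := V.isIntegral

/-- **The blind step as an endomap of normal varieties** (level `N`). [folklore] -/
def step (N : ℕ) (V : NormalVariety k) : NormalVariety k where
  X := hsStep V.X V.hom N
  hom := hsStep.π V.X V.hom N ≫ V.hom
  isSeparated := inferInstance
  locallyOfFiniteType := inferInstance
  quasiCompact := inferInstance
  isIntegral := inferInstance
  normal := hsStep.isIntegrallyClosed_stalk V.X V.hom N

/-- The morphism `V₁ → V` of the blind step. [folklore] -/
def stepπ (N : ℕ) (V : NormalVariety k) : (V.step N).X ⟶ V.X :=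
  hsStep.π V.X V.hom N

/-- The underlying scheme of the step. [folklore] -/
@[simp] theorem step_X (N : ℕ) (V : NormalVariety k) : (V.step N).X = hsStep V.X V.hom N := rfl

/-- The structure morphism of the step factors through `V₁ → V`. [folklore] -/
@[simp] theorem step_hom (N : ℕ) (V : NormalVariety k) :
    (V.step N).hom = V.stepπ N ≫ V.hom := rfl

/-- `V₁ → V` is proper. [folklore] -/
instance isProper_stepπ (N : ℕ) (V : NormalVariety k) : IsProper (V.stepπ N) :=
  inferInstanceAs (IsProper (hsStep.π V.X V.hom N))

/-- `V₁ → V` is birational. [folklore] -/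
theorem isBirational_stepπ (N : ℕ) (V : NormalVariety k) : IsBirational (V.stepπ N) :=
  hsStep.isBirational V.X V.hom N

/-- **The blind tower** `V_n := step^[n] V` comes with `V_n → V`: the composite of the steps.
[folklore] -/
def iterπ (N : ℕ) : (n : ℕ) → (V : NormalVariety k) → ((step N)^[n] V).X ⟶ V.X
  | 0, V => 𝟙 V.X
  | n + 1, V => iterπ N n (V.step N) ≫ V.stepπ N

/-- `V_0 → V` is the identity. [folklore] -/
@[simp] theorem iterπ_zero (N : ℕ) (V : NormalVariety k) : iterπ N 0 V = 𝟙 V.X := rfl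

/-- `V_{n+1} → V` is `V_{n+1} → V_1 → V`. [folklore] -/
theorem iterπ_succ (N n : ℕ) (V : NormalVariety k) :
    iterπ N (n + 1) V = iterπ N n (V.step N) ≫ V.stepπ N := rfl

/-- `V_{n+1} → V` on points. [folklore] -/
theorem iterπ_succ_apply (N n : ℕ) (V : NormalVariety k) (y : ((step N)^[n] (V.step N)).X) :
    (iterπ N (n + 1) V).base y = (V.stepπ N).base ((iterπ N n (V.step N)).base y) := rfl

/-- **The tower is regular over `x` at stage `n`**: every point of `V_n` above `x ∈ V` has a
regular local ring. [folklore] -/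
def IsResolvedOver (N n : ℕ) (V : NormalVariety k) (x : V.X) : Prop :=
  ∀ y : ((step N)^[n] V).X, (iterπ N n V).base y = x →
    IsRegularLocalRing (((step N)^[n] V).X.presheaf.stalk y)

end NormalVariety


/-! ## Definitional glue (registered stub `stub_hsTowerDefs` of line `Sketch`) -/

/-- **Stub `stub_hsTowerDefs`** (line `Sketch` of crux `LocalToGlobal`; definitional glue): the
tower map of stage `n+1` is the tower map of stage `n` of `V₁` followed by the step `V₁ → V`
(`rfl`, by the structural recursion defining `NormalVariety.iterπ`). [folklore] -/
theorem stub_hsTowerDefs (k : Type) [Field k] (V : NormalVariety k) (N n : ℕ) :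
    NormalVariety.iterπ N (n + 1) V = NormalVariety.iterπ N n (V.step N) ≫ V.stepπ N := rfl

end Summit.ResolutionOfSingularities.ResolutionOfSingularities.Theorems.LocalToGlobal.HSTower

end
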